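import Literature.NumberTheory.EllipticCurves.PoonenRainsCocycle
import Literature.NumberTheory.EllipticCurves.TwoAdicImageSurjectivityModTwoProofs
import Literature.NumberTheory.EllipticCurves.TwoTorsionChordIdentities
import HarnessLib

/-!
# Kummer isotropy for the Poonen–Rains form at level `2`, I: the theta cocycle on a Kummer cocycle

Setting: `E/K` elliptic (model `W`, `2 ≠ 0`), a `K`-field `L` (a completion), `F = L̄ ⊇ K̄` via the tree's
embedding `ι = closureEmb L`, `Q ∈ E(F)` with `2Q ∈ E(L)`, and the local Kummer cocycle
`ξ_σ = θ⁻¹(σQ − Q) ∈ E[2](K̄)` (`WeierstrassCurve.localKummerCocycle`).  This file computes the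
`K̄ˣ`-valued theta cocycle `conn ξ (σ,τ) = χ_σ(ξ_τ)·m(ξ_σ, σξ_τ)` of the level-`2` Heisenberg datum
(`heisenbergGm`, frame `v_T = s_T u_T`) EXPLICITLY:

* `coe_toMul_conn_heisenbergGm_comap` — **`conn(σ,τ) = σ(s_{ξτ}) · s_{ξσ} · M(ξσ, σξτ) / s_{ξ(στ)}`**
  (`M` = Mumford's theta table `gmTable`, `s` the chosen square roots), for any crossed homomorphism
  `ξ` of any `Γ → Γ_K`;
* transport along `ι`: `closureEmb_smul` (`ι(θσ·a) = σ·ι(a)`), `map_gmTable` (`ι ∘ M = tableOf (ι ∘ x)`),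
  `map_four_Droot` (`Ψ′_F(ι eᵢ) = 4 ι(Dᵢ)`, Vieta);
* the GEOMETRY of the Kummer cocycle: `smul_eq_add_pointsMap` (`σQ = Q + ι(ξ_σ)`),
  `pointsMap_T` (the `2`-torsion points over `F` are `(ι eᵢ, ι tᵢ)`), and for `2Q ≠ O` the chord
  description `addX_eq_translAbsc'` (`x(Q + Tᵢ) = ι eᵢ + ι Dᵢ/(x_Q − ι eᵢ)`, from (T1)
  `four_mul_sub_mul_addX_sub` and Vieta).

With `A_mul_A_mul_table` / `div_sq_eq_one_of_chord` (`ThetaIsotropyIdentities`) these give the explicit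
`μ₂`-valued splitting of the Poonen–Rains cocycle on Kummer classes (sequel: `prClass (κ(Q)) = 0`,
Poonen–Rains 2012 Prop. 4.8).  References: [PoonenRains2012] §4.1, Prop. 4.8; [SilvermanAEC2009] III.2.3,
VIII.§2 (Kummer pairing via halves of points).  No named fact.
-/

set_option autoImplicit false

noncomputable section

open scoped Classical

namespace Literature.NumberTheory.EllipticCurves

namespace ThetaLevelTwo

open Literature.Algebra.Homology
open Literature.NumberTheory.GaloisRepresentations Literature.NumberTheory.GaloisRepresentations.DiscreteGaloisModule
open Literature.NumberTheory.EllipticCurves.DokchitserDokchitser2012 (vec idx frame T xT permGal T_permGal smul_xT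
  coe_T_ne_zero eq_zero_or_eq_T roots_twoTorsionPolynomial)
open WeierstrassCurve Field

universe u

variable {K : Type u} [Field K] (W : WeierstrassCurve K) [W.IsElliptic] (h2 : (2 : K) ≠ 0)

/-! ### The theta cocycle of a crossed homomorphism, explicitly in `K̄` -/

/-- **The `K̄ˣ`-valued theta cocycle, explicitly**: for a crossed homomorphism `ξ` of `Γ` (acting through
`θ : Γ → Γ_K`), `conn ξ (σ,τ) = θσ(s_{ξτ}) · s_{ξσ} · M(ξσ, θσ ξτ) / s_{ξ(στ)}` in `K̄`, where `s_P` is the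
chosen square root attached to the frame letter of `P` and `M` the theta table.
[cite: PoonenRains2012, Prop. 4.5 and Cor. 4.6 (Heisenberg group and its connecting map)] -/
theorem coe_toMul_conn_heisenbergGm_comap {Γ : Type*} [Monoid Γ] (θ : Γ →* absoluteGaloisGroup K)
    (ξ : Γ → geomTorsion W 2) (hξ : ((heisenbergGm W h2).comap θ).IsCrossedHom ξ) (σ τ : Γ) :
    ((Additive.toMul (((heisenbergGm W h2).comap θ).conn ξ σ τ) : (AlgebraicClosure K)ˣ) : AlgebraicClosure K)
      = (θ σ • (((thetaData W h2).sUnit (frame W h2 (ξ τ)) : (AlgebraicClosure K)ˣ) : AlgebraicClosure K))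
        * ((thetaData W h2).sUnit (frame W h2 (ξ σ)) : AlgebraicClosure K)
        * (thetaData W h2).gmTable (frame W h2 (ξ σ)) (frame W h2 (θ σ • ξ τ))
        / ((thetaData W h2).sUnit (frame W h2 (ξ (σ * τ))) : AlgebraicClosure K) := by
  have hστ : ξ (σ * τ) = ξ σ + θ σ • ξ τ := hξ σ τ
  rw [HeisenbergDatum.conn_apply, HeisenbergDatum.comap_χ, HeisenbergDatum.comap_m, HeisenbergDatum.comap_ρ_apply,
    heisenbergGm_ρ_apply, heisenbergGm_χ, heisenbergGm_m, toMul_add, Units.val_mul,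
    ThetaData.toMul_thetaDatum_χ, ThetaData.toMul_thetaDatum_m, hστ, map_add, frame_smul]
  simp only [Units.val_div_eq_div_val, Units.val_mul, ThetaData.coe_toMul_unitsAction, toMul_ofMul,
    ThetaData.coe_gmUnit]
  have hs : ∀ v : V, ((thetaData W h2).sUnit v : AlgebraicClosure K) ≠ 0 := fun v => ((thetaData W h2).sUnit v).ne_zero
  rw [show (thetaData W h2).ρ = frameAction W h2 from rfl, ← frame_smul W h2 (θ σ) (ξ τ)]
  field_simp

/-! ### Transport along the embedding `ι : K̄ → L̄` -/

variable (L : Type u) [Field L] [Algebra K L]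

/-- The embedding `ι = closureEmb L : K̄ → L̄` intertwines the restriction `θ = absGaloisRestrict K L`:
`ι(θσ · a) = σ · ι(a)`. [cite: SerreGaloisCohomology1997, II.§1.1 (compatible pairs for a field extension)] -/
theorem closureEmb_smul (σ : absoluteGaloisGroup L) (a : AlgebraicClosure K) :
    closureEmb (K := K) L (absGaloisRestrict K L σ • a) = σ • closureEmb (K := K) L a := by
  rw [← resGal_eq_absGaloisRestrict, resGal_eq]
  exact apply_resGalAuxOfEmb_apply (closureEmb (K := K) L) σ a

/-- `ι` maps the theta table of `K̄` to the theta table of the embedded roots (`ι` is a ring map).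
[cite: PoonenRains2012, §4.1 (functoriality of the Heisenberg group in the field)] -/
theorem map_gmTable (v w : V) :
    closureEmb (K := K) L ((thetaData W h2).gmTable v w)
      = (if v = 0 ∨ w = 0 then (1 : AlgebraicClosure L) else if v = w then
          (closureEmb (K := K) L ((thetaData W h2).x (idx v) - (thetaData W h2).x (idx v + 1))
            * closureEmb (K := K) L ((thetaData W h2).x (idx v) - (thetaData W h2).x (idx v + 2)))⁻¹
        else (closureEmb (K := K) L ((thetaData W h2).x (idx v)) - closureEmb (K := K) L ((thetaData W h2).x (idx w)))⁻¹) := by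
  unfold ThetaData.gmTable ThetaData.D
  split_ifs <;> simp [map_sub, map_mul]

/-! ### The geometry of the local Kummer cocycle -/

variable [CharZero K]

/-- `σ • Q = Q + ι(ξ_σ)` for the local Kummer cocycle `ξ` of `Q` (`2Q ∈ E(L)`).
[cite: SilvermanAEC2009, VIII.§2 (the Kummer pairing κ(P, σ) = σQ − Q)] -/
theorem smul_eq_add_pointsMap (Q : localPoints W L)
    (hQ : (2 : ℤ) • Q ∈ MulAction.fixedPoints (absoluteGaloisGroup L) (localPoints W L)) (σ : absoluteGaloisGroup L) :
    σ • Q = Q + pointsMap W L ((W.localKummerCocycle 2 two_ne_zero Q hQ).1 σ : geomTorsion W 2) := by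
  rw [W.pointsMap_localKummerCocycle_apply 2 two_ne_zero Q hQ σ]
  abel

omit [W.IsElliptic] [CharZero K] in
/-- The image in `E(L̄)` of a point of `E(K̄)` with coordinates `(x, y)` has coordinates `(ι x, ι y)`.
[cite: SilvermanAEC2009, X.§4 (points over K̄ inside K̄_v)] -/
theorem pointsMap_some {x y : AlgebraicClosure K}
    (h : (W.baseChange (AlgebraicClosure K)).toAffine.Nonsingular x y) :
    ∃ h' : (W.baseChange (AlgebraicClosure L)).toAffine.Nonsingular (closureEmb (K := K) L x) (closureEmb (K := K) L y),
      pointsMap W L (Affine.Point.some x y h : geomPoints W) = Affine.Point.some _ _ h' :=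
  ⟨_, Affine.Point.map_some (f := closureEmb (K := K) L) h⟩

omit [CharZero K] in
/-- The nonzero `2`-torsion point `Tᵢ ∈ E(K̄)` has affine coordinates `(xᵢ, yᵢ)` with `xᵢ = xT i`.
[cite: SilvermanAEC2009, III.2.3 (2-torsion points)] -/
theorem exists_coe_T_eq_some (i : Fin 3) :
    ∃ (x y : AlgebraicClosure K) (h : (W.baseChange (AlgebraicClosure K)).toAffine.Nonsingular x y),
      (T W h2 i : geomPoints W) = Affine.Point.some x y h ∧ xT W h2 i = x := by
  have hne := coe_T_ne_zero W h2 i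
  have hx : xT W h2 i = DokchitserDokchitser2012.xco W (T W h2 i : geomPoints W) := rfl
  revert hne hx
  generalize (T W h2 i : geomPoints W) = P
  intro hne hx
  change (W.baseChange (AlgebraicClosure K)).toAffine.Point at P
  rcases P with _ | ⟨x, y, h⟩
  · exact absurd rfl hne
  · exact ⟨x, y, h, rfl, hx⟩

omit [CharZero K] in
/-- **Vieta over `K̄`, mapped to `L̄`**: `12(ι eᵢ)² + 2b₂(ι eᵢ) + 2b₄ = 4 ι(Dᵢ)` for the base-changed curve
over `L̄` (`Dᵢ = Droot W h2 i`). [cite: SilvermanAEC2009, III.1 and Ex. III.3.7 (d) (the 2-division cubic and its roots)] -/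
theorem derivative_eval_closureEmb_xT (i : Fin 3) :
    12 * closureEmb (K := K) L (xT W h2 i) ^ 2 + 2 * (W.baseChange (AlgebraicClosure L)).b₂ * closureEmb (K := K) L (xT W h2 i)
        + 2 * (W.baseChange (AlgebraicClosure L)).b₄
      = 4 * closureEmb (K := K) L (Droot W h2 i) := by
  have h4 : (4 : K) ≠ 0 := by
    rw [show (4 : K) = 2 * 2 by norm_num]; exact mul_ne_zero h2 h2
  have ha : W.twoTorsionPolynomial.a ≠ 0 := h4
  have h3 := roots_twoTorsionPolynomial W h2
  have hb := Cubic.b_eq_three_roots (φ := algebraMap K (AlgebraicClosure K)) ha h3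
  have hc := Cubic.c_eq_three_roots (φ := algebraMap K (AlgebraicClosure K)) ha h3
  simp only [twoTorsionPolynomial, map_ofNat, map_mul] at hb hc
  -- coefficients of the base change to `L̄` are `ι` of those over `K̄`
  have hb' : (W.baseChange (AlgebraicClosure L)).b₂ = closureEmb (K := K) L (algebraMap K (AlgebraicClosure K) W.b₂) := by
    simp only [baseChange, map_b₂, AlgHom.commutes]
  have hc' : (W.baseChange (AlgebraicClosure L)).b₄ = closureEmb (K := K) L (algebraMap K (AlgebraicClosure K) W.b₄) := by
    simp only [baseChange, map_b₄, AlgHom.commutes]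
  have hS : xT W h2 i + xT W h2 (i + 1) + xT W h2 (i + 2) = xT W h2 0 + xT W h2 1 + xT W h2 2 := by
    fin_cases i <;> simp <;> ring
  have hP : xT W h2 i * xT W h2 (i + 1) + xT W h2 i * xT W h2 (i + 2) + xT W h2 (i + 1) * xT W h2 (i + 2)
      = xT W h2 0 * xT W h2 1 + xT W h2 0 * xT W h2 2 + xT W h2 1 * xT W h2 2 := by
    fin_cases i <;> simp <;> ring
  have key : 12 * xT W h2 i ^ 2 + 2 * algebraMap K (AlgebraicClosure K) W.b₂ * xT W h2 i
      + 2 * algebraMap K (AlgebraicClosure K) W.b₄ = 4 * Droot W h2 i := by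
    simp only [Droot]
    linear_combination (2 * xT W h2 i) * hb + hc + (8 * xT W h2 i) * hS - 4 * hP
  have := congrArg (closureEmb (K := K) L) key
  simp only [map_add, map_mul, map_pow, map_ofNat] at this
  rw [hb', hc']
  exact this

omit [CharZero K] in
/-- **Chord description of the local Kummer cocycle.**  For `Q = (x_Q, y_Q) ∈ E(L̄)` with `2Q ≠ O` and the
`2`-torsion point `ι(Tᵢ) = (ι eᵢ, ι yᵢ)`: `x_Q ≠ ι eᵢ`, and `x(Q + ι Tᵢ) = ι eᵢ + ι Dᵢ/(x_Q − ι eᵢ)`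
((T1) `four_mul_sub_mul_addX_sub` + Vieta). [cite: SilvermanAEC2009, III.2.3 (translation by a 2-torsion point)] -/
theorem addX_closureEmb_xT_eq {xQ yQ : AlgebraicClosure L}
    (hQ : (W.baseChange (AlgebraicClosure L)).toAffine.Nonsingular xQ yQ) (i : Fin 3)
    (hx : xQ ≠ closureEmb (K := K) L (xT W h2 i)) :
    ∀ (y : AlgebraicClosure K) (h : (W.baseChange (AlgebraicClosure K)).toAffine.Nonsingular (xT W h2 i) y),
      (T W h2 i : geomPoints W) = Affine.Point.some (xT W h2 i) y h →
      (W.baseChange (AlgebraicClosure L)).toAffine.addX xQ (closureEmb (K := K) L (xT W h2 i))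
          ((W.baseChange (AlgebraicClosure L)).toAffine.slope xQ (closureEmb (K := K) L (xT W h2 i)) yQ
            (closureEmb (K := K) L y))
        = closureEmb (K := K) L (xT W h2 i)
          + closureEmb (K := K) L (Droot W h2 i) / (xQ - closureEmb (K := K) L (xT W h2 i)) := by
  intro y h hT
  obtain ⟨h', hmap⟩ := pointsMap_some W L h
  -- `ι Tᵢ` is `2`-torsion, so `η(ι Tᵢ) = 0`
  have h2T' : pointsMap W L ((T W h2 i : geomPoints W) + (T W h2 i : geomPoints W)) = 0 := by
    rw [DokchitserDokchitser2012.coe_add_self_eq_zero W, map_zero]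
  rw [map_add, hT, hmap] at h2T'
  have h2T : (Affine.Point.some _ _ h' : (W.baseChange (AlgebraicClosure L)).toAffine.Point)
      + Affine.Point.some _ _ h' = 0 := h2T'
  have ht : 2 * closureEmb (K := K) L y + (W.baseChange (AlgebraicClosure L)).a₁ * closureEmb (K := K) L (xT W h2 i)
      + (W.baseChange (AlgebraicClosure L)).a₃ = 0 :=
    (TwoTorsionChord.eta_eq_zero_iff_add_self_eq_zero (W.baseChange (AlgebraicClosure L)) h').mpr h2T
  have hT1 := TwoTorsionChord.four_mul_sub_mul_addX_sub (W := W.baseChange (AlgebraicClosure L)) hQ.1 h'.1 ht hx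
  rw [derivative_eval_closureEmb_xT W h2 L i] at hT1
  have hx' : xQ - closureEmb (K := K) L (xT W h2 i) ≠ 0 := sub_ne_zero.mpr hx
  have h4 : (4 : AlgebraicClosure L) ≠ 0 := by
    have h2F : (2 : AlgebraicClosure L) ≠ 0 := by
      rw [show (2 : AlgebraicClosure L) = algebraMap K (AlgebraicClosure L) 2 by rw [map_ofNat]]
      exact (map_ne_zero _).mpr h2
    rw [show (4 : AlgebraicClosure L) = 2 * 2 by norm_num]
    exact mul_ne_zero h2F h2F
  have hT1' := mul_left_cancel₀ h4 hT1
  have key : (W.baseChange (AlgebraicClosure L)).toAffine.addX xQ (closureEmb (K := K) L (xT W h2 i))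
        ((W.baseChange (AlgebraicClosure L)).toAffine.slope xQ (closureEmb (K := K) L (xT W h2 i)) yQ
          (closureEmb (K := K) L y)) - closureEmb (K := K) L (xT W h2 i)
      = closureEmb (K := K) L (Droot W h2 i) / (xQ - closureEmb (K := K) L (xT W h2 i)) := by
    rw [eq_div_iff hx']
    linear_combination hT1'
  linear_combination key

end ThetaLevelTwo

end Literature.NumberTheory.EllipticCurves
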